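import Literature.NumberTheory.LFunctions.FordProgram1
import HarnessLib

/-!
# Ford's "Program 1": kernel run 22C (`861 ≤ k ≤ 865`)

Topic `Literature/NumberTheory/LFunctions`. Everything here is PROVED (kernel evaluations, standard
axioms): `FordP1.checkT k = true` for `861 ≤ k ≤ 865`, i.e. the certified re-run of PROGRAM 1 of
K. Ford, Proc. LMS 85 (2002) (the second part of Theorem 3) for these `k` — see `FordProgram1.lean`
for the checker, its soundness `FordP1.row_of_checkK`, and the meaning of the constants
(`ρ = FordP1.rhoOf k / 10⁵`, `θ = FordP1.thetaOf k / 10⁴`, `ω = FordP1.omOf k / 10⁴`). One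
`decide +kernel` per `k` (so that the kernel's evaluation state is bounded by a single run;
`maxHeartbeats 0` lifts the deterministic time-out for each), then the range statement
`FordP1.run22C`. The range `847 ≤ k ≤ 865` was originally one monolithic kernel evaluation
(`FordProgram1Run22.lean`, `decide +kernel` on `(List.range' 847 19).all checkT`), which no longer
completes within the resources of the full build; it is now split into `FordProgram1Run22A.lean`
(`847 ≤ k ≤ 853`), `FordProgram1Run22B.lean` (`854 ≤ k ≤ 860`) and `FordProgram1Run22C.lean`
(`861 ≤ k ≤ 865`), and `FordProgram1Run22.lean` only re-assembles `FordP1.run22` from them. The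
assembly of all runs is `FordTheorem3SmallK.lean`.

## References

* K. Ford, Proc. London Math. Soc. (3) 85 (2002), 565–633; arXiv:1910.08209: Theorem 3, (1.7),
  Lemmas 3.4–3.5, Appendix "PROGRAM 1". [Ford2002]
-/

namespace Literature.NumberTheory.LFunctions
namespace FordP1

set_option maxHeartbeats 0 in
/-- `checkT 861`. [cite: Ford2002, Theorem 3 (second part) and PROGRAM 1] -/
theorem checkT_861 : checkT 861 = true := by
  decide +kernel

set_option maxHeartbeats 0 in
/-- `checkT 862`. [cite: Ford2002, Theorem 3 (second part) and PROGRAM 1] -/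
theorem checkT_862 : checkT 862 = true := by
  decide +kernel

set_option maxHeartbeats 0 in
/-- `checkT 863`. [cite: Ford2002, Theorem 3 (second part) and PROGRAM 1] -/
theorem checkT_863 : checkT 863 = true := by
  decide +kernel

set_option maxHeartbeats 0 in
/-- `checkT 864`. [cite: Ford2002, Theorem 3 (second part) and PROGRAM 1] -/
theorem checkT_864 : checkT 864 = true := by
  decide +kernel

set_option maxHeartbeats 0 in
/-- `checkT 865`. [cite: Ford2002, Theorem 3 (second part) and PROGRAM 1] -/
theorem checkT_865 : checkT 865 = true := by
  decide +kernel

/-- **Kernel run 22C**: `checkT k` for `861 ≤ k ≤ 865`. [cite: Ford2002, Theorem 3 (second part)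
and PROGRAM 1] -/
theorem run22C (k : ℕ) (h1 : 861 ≤ k) (h2 : k ≤ 865) : checkT k = true := by
  interval_cases k
  · exact checkT_861
  · exact checkT_862
  · exact checkT_863
  · exact checkT_864
  · exact checkT_865

end FordP1
end Literature.NumberTheory.LFunctions
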